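import Summits.CriticalPhenomena.PercolationContinuityZ3.Theorems.PercNearOneGluingNoHeavyConstsLinearLowerTailTwoGluedBlocks
import HarnessLib

/-!
# The block criterion: (LT³⁄₂) from glued blocks watched two or four at a time, any observer

builds on p205010 (kernel theorem, internal audit signed; external expert review pending)

PAPER-2 track "percolation constants", part (ii), seat `prim-consts-1`, gen 11 (lane index `run/shared/lean/prim/consts/CONSTANTS.md`,
row A19, §4 N37; memo `FROM-prim-consts-1-g11-GLUED-BLOCK.md` §1).  Support file for the crux `NoHeavyLowerTail`
(stmt-CriticalPhenomena-4575; `--supports`): theorems only, no definitions, no sorries, standard axioms.  Third file of the block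
method after `…ConstsLinearLowerTailGluedBlock` and `…ConstsLinearLowerTailTwoGluedBlocks`.

Notation: finite weighted graph on `Fin n` (`μ = prodBernoulli w`), relay set `A`, observer `o` (no hypothesis), `N = |C(o) ∩ A|`,
`EN = Σ_{a∈A} P(o ↔ a) ≤ |A|`, `s ≥ max_{a,a'∈A} P(a ↮ a')`, bad event `{1 ≤ N < κ·EN}`, `0 < κ ≤ 2/3`, block count
`N_a = |{b ∈ A : a ↔ b}|`, threshold `k = |A| − ⌊|A|/3⌋ = ⌈2|A|/3⌉`, `L₀ = ⌊|A|/3⌋ + 1` (`N_a < k ⟺ a loses ≥ L₀ relay points`).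
GLUED PARTITION: an ANCHOR MAP `c : Fin n → Fin n` with `P(c(a) ↮ a) = 0` for every `a ∈ A` (a free relay point is its own anchor,
`c a = a`; a block is the set of relay points with a common anchor; weight-`1` stars, cliques, or any a.s.-connected gadget qualify).
The MASS outside some blocks is the number of relay points whose anchor differs from the listed anchors.

THE CRITERION.  Off the glue null set, the set `S` of relay points cut from `a` is a union of whole blocks avoiding `a`'s block, and
`N_a < k ⟺ |S| ≥ L₀`.  Hence:
* (two watched points) if `y, z ∈ A` lie outside `a`'s block and the mass outside the blocks of `a, y, z` is `< L₀`, then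
  `{N_a < k} ⊆ {a ↮ y} ∪ {a ↮ z}` a.s., whose probability is `≤ (3/2)s` (three pairwise budgets, halved);
* (four watched points) if `y₀, …, y₃ ∈ A` lie outside `a`'s block and, for each `j₀`, the mass outside the blocks of `a` and of the
  `y_j`, `j ≠ j₀`, is `< L₀`, then a.s. on `{N_a < k}` at least two of the `y_j` are cut from `a`, and the FIVE-POINT LEMMA
  (`Consts.real_two_le_lost_le_three_halves`, vdBHK Thm. 1.3) gives `≤ (3/2)s`.
If every relay point admits one of the two, the footprint transfer `Consts.lowerTail_le_blockDeficit` yields (LT³⁄₂) for the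
instance, any observer (`Consts.real_lowerTail_le_three_halves_of_block_criterion`).  In block-size language (blocks
`β₁ ≥ β₂ ≥ …`, free points = blocks of size `1`, `M = |A|`; `γ₁ ≥ γ₂ ≥ …` the OTHER blocks seen from block `i`): it suffices that for
every block `i` either `β_i + γ₁ + γ₂ ≥ ⌈2M/3⌉` or `β_i + γ₂ + γ₃ + γ₄ ≥ ⌈2M/3⌉`; the condition binds at the lightest block.
Instances: all singletons ⟺ `M ≤ 6` (`…AnyObserver`); two blocks ⟺ `2|F| ≤ β₁ + β₂ + 3` (`…TwoGluedBlocks`); THREE blocks with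
`|F| ≤ ⌊M/3⌋` and `β₁ + |F| ≤ ⌊M/3⌋ + 2` — e.g. three blocks of equal size `m ≥ 2` plus `≤ 3` free points, or blocks `4,4,4` plus
three free points (`Consts.real_lowerTail_le_three_halves_of_three_glued_blocks`, the first class of the lane that uses the five-point
lemma at four DISTINCT blocks beyond `|A| ≤ 6`).  Not coverable this way: block `3` + five free points, blocks `5,5,5` + four free
points (memo §1: these need weighted five-point families, some of which are false).
Declarations: `Consts.lostSet_closed_of_anchor`, `Consts.real_blockDeficit_le_of_two_watched`, `…_of_four_watched`,
`Consts.real_lowerTail_le_three_halves_of_block_criterion`, `Consts.real_lowerTail_le_three_halves_of_three_glued_blocks`.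
References: G. Kozma, N. Nitzan, arXiv:2401.12397 (2024), Conjecture 1 (p. 3), Conjecture 4 (p. 32); J. van den Berg, O. Häggström,
J. Kahn, Random Structures Algorithms 29 (2006), Thm. 1.3; G. Grimmett, *Percolation* (1999), §1.3.
-/

noncomputable section

namespace Summit.CriticalPhenomena.PercolationContinuityZ3.Theorems

open MeasureTheory Set Literature.Probability.LatticeModels Literature.Probability.Percolation
open scoped Classical

namespace Consts

/-! ### The lost set is a union of blocks -/

/-- **Off the glue null set the lost set is closed under the anchor map.**  If every `b ∈ A` is joined to its anchor `c b` (in `ω`),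
then for `b, b' ∈ A` with the same anchor, `a ↮ b` implies `a ↮ b'`; and `a` is joined to every point of its own block.
[folklore] -/
theorem lostSet_closed_of_anchor {n : ℕ} (A : Finset (Fin n)) (c : Fin n → Fin n) (a : Fin n) (ha : a ∈ A)
    (ω : BondConfig (Fin n)) (hatt : ∀ b ∈ A, ω ∈ openConn (c b) b) :
    (∀ b ∈ A, ∀ b' ∈ A, c b' = c b → ω ∉ openConn a b → ω ∉ openConn a b') ∧
      (∀ b ∈ A, c b = c a → ω ∈ openConn a b) := by
  constructor
  · intro b hb b' hb' hcc hab hab'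
    apply hab
    have h1 : ω ∈ openConn (c b') b' := hatt b' hb'  -- `a ↔ b' ↔ c b' = c b ↔ b`
    rw [hcc] at h1
    exact SimpleGraph.Reachable.trans hab' (SimpleGraph.Reachable.trans (SimpleGraph.Reachable.symm h1) (hatt b hb))
  · intro b hb hcb
    have h2 : ω ∈ openConn (c b) b := hatt b hb
    rw [hcb] at h2
    exact SimpleGraph.Reachable.trans (SimpleGraph.Reachable.symm (hatt a ha)) h2

/-- The glue null set of an anchor map: `μ(⋃_{b∈A} {c b ↮ b}) = 0` when each `P(c b ↮ b) = 0`. [folklore] -/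
theorem real_biUnion_compl_openConn_anchor_eq_zero (n : ℕ) (w : Sym2 (Fin n) → unitInterval) (A : Finset (Fin n))
    (c : Fin n → Fin n) (hglue : ∀ b ∈ A, (prodBernoulli w).real (openConn (c b) b)ᶜ = 0) :
    (prodBernoulli w).real (⋃ b ∈ A, (openConn (c b) b)ᶜ) = 0 := by
  refine le_antisymm ?_ measureReal_nonneg
  calc (prodBernoulli w).real (⋃ b ∈ A, (openConn (c b) b)ᶜ) ≤ ∑ b ∈ A, (prodBernoulli w).real (openConn (c b) b)ᶜ :=
        measureReal_biUnion_finset_le _ _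
    _ = 0 := Finset.sum_eq_zero fun b hb => hglue b hb

/-- Counting: if the lost set of `a` (within `A`) is contained in a set `R` with `|R| + k ≤ |A|`, then `N_a ≥ k`. [folklore] -/
theorem not_blockDeficit_of_lostSet_subset {n : ℕ} (A R : Finset (Fin n)) (a : Fin n) (ω : BondConfig (Fin n)) (k : ℕ)
    (hsub : (A.filter fun b => ω ∉ openConn a b) ⊆ R) (hR : R.card + k ≤ A.card) :
    ¬ (A.filter fun b => ω ∈ openConn a b).card < k := by
  have hsplit := Finset.card_filter_add_card_filter_not (s := A) (fun b => ω ∈ openConn a b)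
  have hle := Finset.card_le_card hsub
  omega

/-! ### Block deficits with two or four watched points -/

/-- **Two watched points.**  Anchor map `c` gluing `A` almost surely; `a ∈ A`; `y, z ∈ A ∖ {a}`; the relay points outside the
blocks of `a, y, z` number at most `|A| − k`.  Then `μ(N_a < k) ≤ (3/2)·s`: a.s. on `{N_a < k}` the lost set, a union of
blocks avoiding `a`'s block of size `≥ |A| + 1 − k`, must contain `y` or `z`. [cite: KozmaNitzan2024, Conj. 4 (p. 32)] -/
theorem real_blockDeficit_le_of_two_watched (n : ℕ) (w : Sym2 (Fin n) → unitInterval) (A : Finset (Fin n))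
    (c : Fin n → Fin n) (hglue : ∀ b ∈ A, (prodBernoulli w).real (openConn (c b) b)ᶜ = 0) (k : ℕ) {s : ℝ}
    (hrel : ∀ b ∈ A, ∀ b' ∈ A, (prodBernoulli w).real (openConn b b')ᶜ ≤ s) (a : Fin n) (ha : a ∈ A)
    (y z : Fin n) (hy : y ∈ A) (hz : z ∈ A) (hya' : y ≠ a) (hza' : z ≠ a)
    (hmass : (A.filter fun b => c b ≠ c a ∧ c b ≠ c y ∧ c b ≠ c z).card + k ≤ A.card) :
    (prodBernoulli w).real {ω : BondConfig (Fin n) | (A.filter fun b => ω ∈ openConn a b).card < k} ≤ 3 / 2 * s := by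
  refine real_le_three_halves_of_two_lost_ae n w A a ha hrel ![y, y, z, z]
    (fun j => by fin_cases j <;> simp [hy, hz]) (fun j => by fin_cases j <;> simp [hya', hza']) _ _
    (real_biUnion_compl_openConn_anchor_eq_zero n w A c hglue) ?_
  rintro ω ⟨hN, hωZ⟩
  simp only [mem_setOf_eq] at hN ⊢
  have hatt : ∀ b ∈ A, ω ∈ openConn (c b) b := by
    intro b hb
    by_contra h
    exact hωZ (Set.mem_iUnion₂.2 ⟨b, hb, h⟩)
  obtain ⟨hclosed, hown⟩ := lostSet_closed_of_anchor A c a ha ω hatt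
  by_cases hy' : ω ∈ openConn a y
  · by_cases hz' : ω ∈ openConn a z
    · -- both watched points kept: the lost set avoids the blocks of `a, y, z`
      exfalso
      refine not_blockDeficit_of_lostSet_subset A _ a ω k ?_ hmass hN
      intro b hb
      have hb' := Finset.mem_filter.1 hb
      refine Finset.mem_filter.2 ⟨hb'.1, fun h => hb'.2 (hown b hb'.1 h), fun h => hb'.2 ?_, fun h => hb'.2 ?_⟩
      · by_contra hab
        exact hclosed b hb'.1 y hy h.symm hab hy'
      · by_contra hab
        exact hclosed b hb'.1 z hz h.symm hab hz'
    · refine Finset.one_lt_card.2 ⟨2, ?_, 3, ?_, by decide⟩ <;> simp [hz']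
  · refine Finset.one_lt_card.2 ⟨0, ?_, 1, ?_, by decide⟩ <;> simp [hy']

/-- **Four watched points.**  Anchor map `c` gluing `A` almost surely; `a ∈ A`; `y₀, …, y₃ ∈ A ∖ {a}` (repetitions allowed) such
that for every `j₀` the relay points outside the blocks of `a` and of the `y_j`, `j ≠ j₀`, number at most `|A| − k`.  Then
`μ(N_a < k) ≤ (3/2)·s`: a.s. on `{N_a < k}` at least two of the `y_j` are cut from `a`, and the five-point lemma applies (vdBHK
Thm. 1.3). [cite: VandenbergHaggstromKahn2005, Thm. 1.3 (p. 6)] -/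
theorem real_blockDeficit_le_of_four_watched (n : ℕ) (w : Sym2 (Fin n) → unitInterval) (A : Finset (Fin n))
    (c : Fin n → Fin n) (hglue : ∀ b ∈ A, (prodBernoulli w).real (openConn (c b) b)ᶜ = 0) (k : ℕ) {s : ℝ}
    (hrel : ∀ b ∈ A, ∀ b' ∈ A, (prodBernoulli w).real (openConn b b')ᶜ ≤ s) (a : Fin n) (ha : a ∈ A)
    (y : Fin 4 → Fin n) (hyA : ∀ j, y j ∈ A) (hya' : ∀ j, y j ≠ a)
    (hmass : ∀ j₀ : Fin 4, (A.filter fun b => c b ≠ c a ∧ ∀ j, j ≠ j₀ → c b ≠ c (y j)).card + k ≤ A.card) :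
    (prodBernoulli w).real {ω : BondConfig (Fin n) | (A.filter fun b => ω ∈ openConn a b).card < k} ≤ 3 / 2 * s := by
  refine real_le_three_halves_of_two_lost_ae n w A a ha hrel y hyA hya' _ _
    (real_biUnion_compl_openConn_anchor_eq_zero n w A c hglue) ?_
  rintro ω ⟨hN, hωZ⟩
  simp only [mem_setOf_eq] at hN ⊢
  have hatt : ∀ b ∈ A, ω ∈ openConn (c b) b := by
    intro b hb
    by_contra h
    exact hωZ (Set.mem_iUnion₂.2 ⟨b, hb, h⟩)
  obtain ⟨hclosed, hown⟩ := lostSet_closed_of_anchor A c a ha ω hatt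
  by_contra hlt
  push Not at hlt
  -- at most one index is lost; fix `j₀` with all other `y_j` kept
  have hle1 : (Finset.univ.filter fun j => ω ∉ openConn a (y j)).card ≤ 1 := Nat.lt_succ_iff.mp hlt
  obtain ⟨j₀, hj₀⟩ : ∃ j₀ : Fin 4, ∀ j, j ≠ j₀ → ω ∈ openConn a (y j) := by
    by_cases h0 : (Finset.univ.filter fun j => ω ∉ openConn a (y j)).card = 0
    · refine ⟨0, fun j _ => ?_⟩
      by_contra hj
      have : j ∈ (Finset.univ.filter fun j => ω ∉ openConn a (y j)) := Finset.mem_filter.2 ⟨Finset.mem_univ _, hj⟩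
      rw [Finset.card_eq_zero.1 h0] at this
      exact absurd this (Finset.notMem_empty _)
    · have h1 : (Finset.univ.filter fun j => ω ∉ openConn a (y j)).card = 1 := by omega
      obtain ⟨j₀, hj₀⟩ := Finset.card_eq_one.1 h1
      refine ⟨j₀, fun j hj => ?_⟩
      by_contra hj'
      have : j ∈ (Finset.univ.filter fun j => ω ∉ openConn a (y j)) := Finset.mem_filter.2 ⟨Finset.mem_univ _, hj'⟩
      rw [hj₀] at this
      exact hj (Finset.mem_singleton.1 this)
  refine not_blockDeficit_of_lostSet_subset A _ a ω k ?_ (hmass j₀) hN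
  intro b hb
  have hb' := Finset.mem_filter.1 hb
  refine Finset.mem_filter.2 ⟨hb'.1, fun h => hb'.2 (hown b hb'.1 h), fun j hj h => hb'.2 ?_⟩
  by_contra hab
  exact hclosed b hb'.1 (y j) (hyA j) h.symm hab (hj₀ j hj)

/-! ### (LT³⁄₂) under the criterion -/

/-- **(LT³⁄₂) from the block criterion, ANY observer, every `0 < κ ≤ 2/3`.**  Anchor map `c` gluing the relay set almost surely;
suppose every relay point `a` admits either two watched points `y, z ≠ a` (mass outside the blocks of `a, y, z` at most `⌊|A|/3⌋`) or
four watched points `y_j ≠ a` (for each `j₀`, mass outside the blocks of `a` and `{y_j}_{j≠j₀}` at most `⌊|A|/3⌋`).  Then `P(1 ≤ N < κ·EN) ≤ (3/2)·s`.  [Footprint transfer `Consts.lowerTail_le_blockDeficit` at `k = |A| − ⌊|A|/3⌋`,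
`Consts.lowerTail_subset_threshold`, and the two deficit bounds.] [cite: KozmaNitzan2024, Conj. 1 (p. 3)] -/
theorem real_lowerTail_le_three_halves_of_block_criterion (n : ℕ) (w : Sym2 (Fin n) → unitInterval) (A : Finset (Fin n))
    (o : Fin n) (c : Fin n → Fin n) (hglue : ∀ b ∈ A, (prodBernoulli w).real (openConn (c b) b)ᶜ = 0)
    (hcrit : ∀ a ∈ A,
      (∃ y ∈ A, ∃ z ∈ A, y ≠ a ∧ z ≠ a ∧
          (A.filter fun b => c b ≠ c a ∧ c b ≠ c y ∧ c b ≠ c z).card ≤ A.card / 3) ∨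
      (∃ y : Fin 4 → Fin n, (∀ j, y j ∈ A) ∧ (∀ j, y j ≠ a) ∧
          ∀ j₀ : Fin 4, (A.filter fun b => c b ≠ c a ∧ ∀ j, j ≠ j₀ → c b ≠ c (y j)).card ≤ A.card / 3))
    {κ s : ℝ} (hκ0 : 0 < κ) (hκ : κ ≤ 2 / 3) (hs : 0 ≤ s)
    (hrel : ∀ a ∈ A, ∀ a' ∈ A, (prodBernoulli w).real (openConn a a')ᶜ ≤ s) :
    (prodBernoulli w).real {ω : BondConfig (Fin n) | 1 ≤ (A.filter fun a => ω ∈ openConn o a).card ∧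
        ((A.filter fun a => ω ∈ openConn o a).card : ℝ) < κ * (∑ a ∈ A, (prodBernoulli w).real (openConn o a))} ≤
      3 / 2 * s := by
  set μ := prodBernoulli w with hμ
  set k : ℕ := A.card - A.card / 3 with hk
  have hk3 : A.card / 3 ≤ A.card := Nat.div_le_self _ _
  have hblk : ∀ a ∈ A, μ.real {ω : BondConfig (Fin n) | (A.filter fun b => ω ∈ openConn a b).card < k} ≤ 3 / 2 * s := by
    intro a ha
    rcases hcrit a ha with ⟨y, hy, z, hz, hya, hza, hmass⟩ | ⟨y, hyA, hya, hmass⟩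
    · exact real_blockDeficit_le_of_two_watched n w A c hglue k hrel a ha y z hy hz hya hza (by omega)
    · exact real_blockDeficit_le_of_four_watched n w A c hglue k hrel a ha y hyA hya (fun j₀ => by have := hmass j₀; omega)
  have htr := lowerTail_le_blockDeficit n w A o k (3 / 2 * s) hblk
  have h32 : 3 / 2 * s * μ.real (⋃ a ∈ A, openConn o a) ≤ 3 / 2 * s := by
    have h0 : 0 ≤ 3 / 2 * s := by linarith
    have h1 : μ.real (⋃ a ∈ A, openConn o a) ≤ 1 := measureReal_le_one
    nlinarith [measureReal_nonneg (μ := μ) (s := ⋃ a ∈ A, openConn o a)]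
  exact le_trans (measureReal_mono (lowerTail_subset_threshold n w A o hκ0 hκ)) (htr.trans h32)

/-! ### Three glued blocks -/

/-- **(LT³⁄₂) for three glued blocks, ANY observer, every `0 < κ ≤ 2/3`.**  Pairwise disjoint nonempty `B₁, B₂, B₃ ⊆ A` almost
surely glued to `t₁, t₂, t₃`, labelled so that `|B₃| ≤ |B₂| ≤ |B₁|`; free part `F = A ∖ (B₁ ∪ B₂ ∪ B₃)` with `|F| ≤ ⌊|A|/3⌋` and
`|B₁| + |F| ≤ ⌊|A|/3⌋ + 2`.  Then `P(1 ≤ N < κ·EN) ≤ (3/2)·s`.  Block points watch one point in each other block (two watched);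
a free point watches `b₁, b₂, b₃` and one further free point (four watched — the five-point lemma at four distinct blocks), or
`b₁, b₂` if it is the only free point.  Examples: three blocks of equal size `m ≥ 2` plus at most three free points (any wiring,
any observer, `EN` up to `3m + 3`); blocks `4,4,4` plus three free points; blocks `5,4,4` plus two.
[cite: KozmaNitzan2024, Conj. 1 (p. 3)] -/
theorem real_lowerTail_le_three_halves_of_three_glued_blocks (n : ℕ) (w : Sym2 (Fin n) → unitInterval) (A : Finset (Fin n))
    (o t₁ t₂ t₃ : Fin n) (B₁ B₂ B₃ : Finset (Fin n)) (hB₁A : B₁ ⊆ A) (hB₂A : B₂ ⊆ A) (hB₃A : B₃ ⊆ A)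
    (h₁₂ : Disjoint B₁ B₂) (h₁₃ : Disjoint B₁ B₃) (h₂₃ : Disjoint B₂ B₃)
    (hne₁ : B₁.Nonempty) (hne₂ : B₂.Nonempty) (hne₃ : B₃.Nonempty)
    (hglue₁ : ∀ b ∈ B₁, (prodBernoulli w).real (openConn t₁ b)ᶜ = 0)
    (hglue₂ : ∀ b ∈ B₂, (prodBernoulli w).real (openConn t₂ b)ᶜ = 0)
    (hglue₃ : ∀ b ∈ B₃, (prodBernoulli w).real (openConn t₃ b)ᶜ = 0)
    (h₃₂ : B₃.card ≤ B₂.card) (h₂₁ : B₂.card ≤ B₁.card)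
    (hF : (A \ (B₁ ∪ B₂ ∪ B₃)).card ≤ A.card / 3) (hmax : B₁.card + (A \ (B₁ ∪ B₂ ∪ B₃)).card ≤ A.card / 3 + 2)
    {κ s : ℝ} (hκ0 : 0 < κ) (hκ : κ ≤ 2 / 3) (hs : 0 ≤ s)
    (hrel : ∀ a ∈ A, ∀ a' ∈ A, (prodBernoulli w).real (openConn a a')ᶜ ≤ s) :
    (prodBernoulli w).real {ω : BondConfig (Fin n) | 1 ≤ (A.filter fun a => ω ∈ openConn o a).card ∧
        ((A.filter fun a => ω ∈ openConn o a).card : ℝ) < κ * (∑ a ∈ A, (prodBernoulli w).real (openConn o a))} ≤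
      3 / 2 * s := by
  set F := A \ (B₁ ∪ B₂ ∪ B₃) with hFdef
  -- the anchor map
  set c : Fin n → Fin n := fun v => if v ∈ B₁ then t₁ else if v ∈ B₂ then t₂ else if v ∈ B₃ then t₃ else v with hcdef
  have hc₁ : ∀ b ∈ B₁, c b = t₁ := fun b hb => by simp [hcdef, hb]
  have hc₂ : ∀ b ∈ B₂, c b = t₂ := fun b hb => by
    have : b ∉ B₁ := Finset.disjoint_right.1 h₁₂ hb
    simp [hcdef, hb, this]
  have hc₃ : ∀ b ∈ B₃, c b = t₃ := fun b hb => by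
    have h1 : b ∉ B₁ := Finset.disjoint_right.1 h₁₃ hb
    have h2 : b ∉ B₂ := Finset.disjoint_right.1 h₂₃ hb
    simp [hcdef, hb, h1, h2]
  have hcF : ∀ b ∈ F, c b = b := fun b hb => by
    have hb' := (Finset.mem_sdiff.1 hb).2
    simp only [Finset.mem_union, not_or] at hb'
    simp [hcdef, hb'.1.1, hb'.1.2, hb'.2]
  have hglue : ∀ b ∈ A, (prodBernoulli w).real (openConn (c b) b)ᶜ = 0 := by
    intro b hb
    by_cases h1 : b ∈ B₁
    · rw [hc₁ b h1]; exact hglue₁ b h1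
    by_cases h2 : b ∈ B₂
    · rw [hc₂ b h2]; exact hglue₂ b h2
    by_cases h3 : b ∈ B₃
    · rw [hc₃ b h3]; exact hglue₃ b h3
    have hbF : b ∈ F := Finset.mem_sdiff.2 ⟨hb, by simp [h1, h2, h3]⟩
    rw [hcF b hbF]
    have : (openConn b b : Set (BondConfig (Fin n))) = univ := Set.eq_univ_of_forall fun ω => SimpleGraph.Reachable.refl _
    rw [this, Set.compl_univ, measureReal_empty]
  obtain ⟨b₁, hb₁⟩ := hne₁
  obtain ⟨b₂, hb₂⟩ := hne₂
  obtain ⟨b₃, hb₃⟩ := hne₃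
  have hcb₁ := hc₁ b₁ hb₁
  have hcb₂ := hc₂ b₂ hb₂
  have hcb₃ := hc₃ b₃ hb₃
  -- cardinalities
  have hU : (B₁ ∪ B₂ ∪ B₃).card = B₁.card + B₂.card + B₃.card := by
    rw [Finset.card_union_of_disjoint (Finset.disjoint_union_left.2 ⟨h₁₃, h₂₃⟩), Finset.card_union_of_disjoint h₁₂]
  have hFA : F.card + (B₁ ∪ B₂ ∪ B₃).card = A.card :=
    Finset.card_sdiff_add_card_eq_card (Finset.union_subset (Finset.union_subset hB₁A hB₂A) hB₃A)
  -- every relay point outside the three blocks lies in `F`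
  have hmemF : ∀ b ∈ A, b ∉ B₁ → b ∉ B₂ → b ∉ B₃ → b ∈ F := fun b hb h1 h2 h3 =>
    Finset.mem_sdiff.2 ⟨hb, by simp [h1, h2, h3]⟩
  refine real_lowerTail_le_three_halves_of_block_criterion n w A o c hglue ?_ hκ0 hκ hs hrel
  intro a ha
  -- a relay point whose anchor differs from `t₁, t₂, t₃` is free
  have key : ∀ b ∈ A, c b ≠ t₁ → c b ≠ t₂ → c b ≠ t₃ → b ∈ F := by
    intro b hb h1 h2 h3
    refine hmemF b hb (fun h => h1 (hc₁ b h)) (fun h => h2 (hc₂ b h)) (fun h => h3 (hc₃ b h))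
  by_cases ha₁ : a ∈ B₁
  · -- watch `b₂, b₃`
    refine Or.inl ⟨b₂, hB₂A hb₂, b₃, hB₃A hb₃, fun h => Finset.disjoint_left.1 h₁₂ ha₁ (h ▸ hb₂),
      fun h => Finset.disjoint_left.1 h₁₃ ha₁ (h ▸ hb₃), le_trans (Finset.card_le_card fun b hb => ?_) hF⟩
    have hb' := Finset.mem_filter.1 hb
    rw [hc₁ a ha₁, hcb₂, hcb₃] at hb'
    exact key b hb'.1 hb'.2.1 hb'.2.2.1 hb'.2.2.2
  by_cases ha₂ : a ∈ B₂
  · refine Or.inl ⟨b₁, hB₁A hb₁, b₃, hB₃A hb₃, fun h => ha₁ (h ▸ hb₁),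
      fun h => Finset.disjoint_left.1 h₂₃ ha₂ (h ▸ hb₃), le_trans (Finset.card_le_card fun b hb => ?_) hF⟩
    have hb' := Finset.mem_filter.1 hb
    rw [hc₂ a ha₂, hcb₁, hcb₃] at hb'
    exact key b hb'.1 hb'.2.2.1 hb'.2.1 hb'.2.2.2
  by_cases ha₃ : a ∈ B₃
  · refine Or.inl ⟨b₁, hB₁A hb₁, b₂, hB₂A hb₂, fun h => ha₁ (h ▸ hb₁), fun h => ha₂ (h ▸ hb₂),
      le_trans (Finset.card_le_card fun b hb => ?_) hF⟩
    have hb' := Finset.mem_filter.1 hb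
    rw [hc₃ a ha₃, hcb₁, hcb₂] at hb'
    exact key b hb'.1 hb'.2.2.1 hb'.2.2.2 hb'.2.1
  -- `a` is free
  have haF : a ∈ F := hmemF a ha ha₁ ha₂ ha₃
  have hca : c a = a := hcF a haF
  have hb₁a : b₁ ≠ a := fun h => ha₁ (h ▸ hb₁)
  have hb₂a : b₂ ≠ a := fun h => ha₂ (h ▸ hb₂)
  have hb₃a : b₃ ≠ a := fun h => ha₃ (h ▸ hb₃)
  by_cases hFa : (F.erase a).Nonempty
  · -- four watched: `b₁, b₂, b₃` and a second free point `d`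
    obtain ⟨d, hd⟩ := hFa
    have hdF : d ∈ F := Finset.mem_of_mem_erase hd
    have hda : d ≠ a := Finset.ne_of_mem_erase hd
    have hcd : c d = d := hcF d hdF
    have hdA : d ∈ A := (Finset.mem_sdiff.1 hdF).1
    have hcardE : ((F.erase a).erase d).card = F.card - 2 := by
      rw [Finset.card_erase_of_mem hd, Finset.card_erase_of_mem haF]; omega
    have hFpos : 2 ≤ F.card := by
      have := Finset.card_pos.2 ⟨d, hd⟩
      rw [Finset.card_erase_of_mem haF] at this; omega
    refine Or.inr ⟨![b₁, b₂, b₃, d], fun j => by fin_cases j <;> simp [hB₁A hb₁, hB₂A hb₂, hB₃A hb₃, hdA],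
      fun j => by fin_cases j <;> simp [hb₁a, hb₂a, hb₃a, hda], fun j₀ => ?_⟩
    -- a free relay point different from `a` and `d` whose anchor avoids two of the three block anchors
    have free_of : ∀ b ∈ A, c b ≠ c a → c b ≠ c d → b ∉ B₁ ∪ B₂ ∪ B₃ → b ∈ (F.erase a).erase d := by
      intro b hb h1 h2 h3
      simp only [Finset.mem_union, not_or] at h3
      have hbF : b ∈ F := hmemF b hb h3.1.1 h3.1.2 h3.2
      rw [hcF b hbF, hca] at h1
      rw [hcF b hbF, hcd] at h2
      exact Finset.mem_erase.2 ⟨h2, Finset.mem_erase.2 ⟨h1, hbF⟩⟩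
    fin_cases j₀
    · -- `B₁` unwatched: the admissible mass is `B₁ ∪ (F ∖ {a, d})`
      calc (A.filter fun b => c b ≠ c a ∧ ∀ j, j ≠ (0 : Fin 4) → c b ≠ c (![b₁, b₂, b₃, d] j)).card
          ≤ (B₁ ∪ (F.erase a).erase d).card := Finset.card_le_card fun b hb => by
            have hb' := Finset.mem_filter.1 hb
            have h2 : c b ≠ t₂ := by have := hb'.2.2 1 (by decide); simpa [hcb₂] using this
            have h3 : c b ≠ t₃ := by have := hb'.2.2 2 (by decide); simpa [hcb₃] using this
            have h4 : c b ≠ c d := by have := hb'.2.2 3 (by decide); simpa using this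
            by_cases hbB₁ : b ∈ B₁
            · exact Finset.mem_union_left _ hbB₁
            · refine Finset.mem_union_right _ (free_of b hb'.1 hb'.2.1 h4 ?_)
              simp only [Finset.mem_union, not_or]
              exact ⟨⟨hbB₁, fun h => h2 (hc₂ b h)⟩, fun h => h3 (hc₃ b h)⟩
        _ ≤ B₁.card + ((F.erase a).erase d).card := Finset.card_union_le _ _
        _ ≤ A.card / 3 := by rw [hcardE]; omega
    · calc (A.filter fun b => c b ≠ c a ∧ ∀ j, j ≠ (1 : Fin 4) → c b ≠ c (![b₁, b₂, b₃, d] j)).card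
          ≤ (B₂ ∪ (F.erase a).erase d).card := Finset.card_le_card fun b hb => by
            have hb' := Finset.mem_filter.1 hb
            have h1 : c b ≠ t₁ := by have := hb'.2.2 0 (by decide); simpa [hcb₁] using this
            have h3 : c b ≠ t₃ := by have := hb'.2.2 2 (by decide); simpa [hcb₃] using this
            have h4 : c b ≠ c d := by have := hb'.2.2 3 (by decide); simpa using this
            by_cases hbB₂ : b ∈ B₂
            · exact Finset.mem_union_left _ hbB₂
            · refine Finset.mem_union_right _ (free_of b hb'.1 hb'.2.1 h4 ?_)
              simp only [Finset.mem_union, not_or]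
              exact ⟨⟨fun h => h1 (hc₁ b h), hbB₂⟩, fun h => h3 (hc₃ b h)⟩
        _ ≤ B₂.card + ((F.erase a).erase d).card := Finset.card_union_le _ _
        _ ≤ A.card / 3 := by rw [hcardE]; omega
    · calc (A.filter fun b => c b ≠ c a ∧ ∀ j, j ≠ (2 : Fin 4) → c b ≠ c (![b₁, b₂, b₃, d] j)).card
          ≤ (B₃ ∪ (F.erase a).erase d).card := Finset.card_le_card fun b hb => by
            have hb' := Finset.mem_filter.1 hb
            have h1 : c b ≠ t₁ := by have := hb'.2.2 0 (by decide); simpa [hcb₁] using this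
            have h2 : c b ≠ t₂ := by have := hb'.2.2 1 (by decide); simpa [hcb₂] using this
            have h4 : c b ≠ c d := by have := hb'.2.2 3 (by decide); simpa using this
            by_cases hbB₃ : b ∈ B₃
            · exact Finset.mem_union_left _ hbB₃
            · refine Finset.mem_union_right _ (free_of b hb'.1 hb'.2.1 h4 ?_)
              simp only [Finset.mem_union, not_or]
              exact ⟨⟨fun h => h1 (hc₁ b h), fun h => h2 (hc₂ b h)⟩, hbB₃⟩
        _ ≤ B₃.card + ((F.erase a).erase d).card := Finset.card_union_le _ _
        _ ≤ A.card / 3 := by rw [hcardE]; omega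
    · -- `d` unwatched: the admissible mass is `F ∖ {a}`
      calc (A.filter fun b => c b ≠ c a ∧ ∀ j, j ≠ (3 : Fin 4) → c b ≠ c (![b₁, b₂, b₃, d] j)).card
          ≤ (F.erase a).card := Finset.card_le_card fun b hb => by
            have hb' := Finset.mem_filter.1 hb
            have h1 : c b ≠ t₁ := by have := hb'.2.2 0 (by decide); simpa [hcb₁] using this
            have h2 : c b ≠ t₂ := by have := hb'.2.2 1 (by decide); simpa [hcb₂] using this
            have h3 : c b ≠ t₃ := by have := hb'.2.2 2 (by decide); simpa [hcb₃] using this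
            have hbF : b ∈ F := key b hb'.1 h1 h2 h3
            have hne : c b ≠ c a := hb'.2.1
            rw [hcF b hbF, hca] at hne
            exact Finset.mem_erase.2 ⟨hne, hbF⟩
        _ ≤ A.card / 3 := by rw [Finset.card_erase_of_mem haF]; omega
  · -- `a` is the only free point: watch `b₁, b₂`; the admissible mass is `B₃`, the lightest block
    have hFa' : F.erase a = ∅ := Finset.not_nonempty_iff_eq_empty.1 hFa
    have hF1 : F.card = 1 := by
      have := Finset.card_erase_of_mem haF
      rw [hFa', Finset.card_empty] at this
      have hpos := Finset.card_pos.2 ⟨a, haF⟩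
      omega
    refine Or.inl ⟨b₁, hB₁A hb₁, b₂, hB₂A hb₂, hb₁a, hb₂a, ?_⟩
    calc (A.filter fun b => c b ≠ c a ∧ c b ≠ c b₁ ∧ c b ≠ c b₂).card ≤ B₃.card :=
          Finset.card_le_card fun b hb => by
            have hb' := Finset.mem_filter.1 hb
            rw [hcb₁, hcb₂] at hb'
            by_contra hb3
            by_cases h1 : b ∈ B₁
            · exact hb'.2.2.1 (hc₁ b h1)
            by_cases h2 : b ∈ B₂
            · exact hb'.2.2.2 (hc₂ b h2)
            have hbF : b ∈ F := hmemF b hb'.1 h1 h2 hb3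
            have hne : c b ≠ c a := hb'.2.1
            rw [hcF b hbF, hca] at hne
            have : b ∈ F.erase a := Finset.mem_erase.2 ⟨hne, hbF⟩
            rw [hFa'] at this
            exact Finset.notMem_empty _ this
      _ ≤ A.card / 3 := by omega

end Consts

end Summit.CriticalPhenomena.PercolationContinuityZ3.Theorems
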